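import Mathlib
import Summits.ResolutionOfSingularities.ResolutionOfSingularities.Theorems.WeightedInvariantLocalWeightedDropAxisNormalize
import Summits.ResolutionOfSingularities.ResolutionOfSingularities.Theorems.WeightedInvariantLocalWeightedDropAxisPreparation
import Literature.AlgebraicGeometry.Resolution.CobordantArcLemma
import Literature.AlgebraicGeometry.Resolution.FormalInverseFunction

/-!
# `LocalWeightedDrop`, TOT2-LINE piece S-E1 (decorated half): PREPARED AXIS PRESENTATIONS exist (entry lemma) and are read through
# formal coordinate changes and units

Route `ResolutionOfSingularities/WeightedInvariant`, engine crux `LocalWeightedDrop` (stmt-ResolutionOfSingularities-8899), chain w43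
[OURS · L1 W4.3 · TOT2-LINE v1.1 §(E) S-E1 (res-L1-w43-lead-1 g4); decorated half = res-type-056, core = res-L1-w43-stub-4].  Elementary
bookkeeping over `k⟦x'₁, …, x'ₙ, z⟧` in the vocabulary of `Literature/…/AxisPolyhedron.lean`; nothing here is a statement of any manuscript.
No definitions.

THE REGIME (E1) of the decorated strategy reads Hironaka's one-free-variable polyhedron `Δ(g; x'; z)` of `g = f · ∏ (old letters)` in PREPARED
AXIS COORDINATES, while the count game moves in the position's own letters.  A PREPARED AXIS PRESENTATION of `g` of order `d` is a formal
coordinate change `θ` with `θ^* g = u · P`, `u(0) ≠ 0`, `P` of order `d` with `AxisCone d P`, `TrivialApexX d P`, `PreparedAxis d P`,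
`¬ InAxisIdeal d P` (written out; no structure is introduced).  This file provides:
* `order_subst_eq_of_legal` — formal coordinate changes preserve the order (both inequalities from `exists_comp_inverse`);
* `coeff_unit_mul_of_degree_le`, `initEval_unit_mul`, `order_unit_mul` — a unit factor rescales the degree-`ord` form by `u(0)` and keeps the order;
* `axisNormalize` — B5 `stub_axisNormalize` FOR EVERY ORDER `d` (its registered statement carries `IsSingular` and `2 < d`, which its proof does
  not use; re-derived here verbatim from its public lemmas): over an infinite field, if the degree-`d` form has a one-dimensional apex then after
  an invertible linear change the germ is an axis germ (`AxisCone`, `TrivialApexX`);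
* `exists_prepared_presentation` — THE ENTRY LEMMA of regime (E1): one-dimensional apex (`hone`/`hcol` in the shapes of `AxisCut.axisStartsWon`)
  and ISOLATION «no formal coordinate change makes `g` equimultiple along the axis» (`¬ InAxisIdeal d (Φ^* g)` for every legal `Φ`) give a legal
  `θ` with `θ^* g` a prepared axis germ of order `d` with `¬ InAxisIdeal` (normalise, then B1 `stub_axisPreparation`; isolation excludes the
  equimultiple branch of B1).
-/

set_option linter.dupNamespace false -- mandated namespace of this single-conjunct summit

namespace Summit.ResolutionOfSingularities.ResolutionOfSingularities.Theorems

open Literature.AlgebraicGeometry.Resolution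

namespace TOT2E1

open MvPowerSeries AxisPolyhedron

variable {k : Type} [Field k] {n : ℕ}

/-! ### Composition and inversion of formal coordinate changes
(local copies of the plumbing of `…GlobalizeLocalDropCanonize`, which is not imported here to stay out of the route's import cone) -/

/-- A substitution by series without constant terms does not change the constant term. -/
theorem constantCoeff_subst_of_constantCoeff_zero {N : ℕ} {τ : Type*} (a : Fin N → MvPowerSeries τ k)
    (ha : ∀ i, constantCoeff (a i) = 0) (u : MvPowerSeries (Fin N) k) : constantCoeff (subst a u) = constantCoeff u := by
  have has := hasSubst_of_constantCoeff_zero ha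
  have hsplit : u = C (constantCoeff u) + (u - C (constantCoeff u)) := by ring
  conv_lhs => rw [hsplit]
  rw [subst_add has, subst_C, map_add, constantCoeff_C, constantCoeff_subst_eq_zero has ha (by simp), add_zero]

/-- The components of a composite substitution have zero constant terms. -/
theorem constantCoeff_comp_eq_zero {N : ℕ} {φ θ : Fin N → MvPowerSeries (Fin N) k}
    (hφ0 : ∀ i, constantCoeff (φ i) = 0) (hθ0 : ∀ i, constantCoeff (θ i) = 0) (i : Fin N) :
    constantCoeff (subst θ (φ i)) = 0 :=
  constantCoeff_subst_eq_zero (hasSubst_of_constantCoeff_zero hθ0) hθ0 (hφ0 i)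

/-- CHAIN RULE for linear parts: `linMat (θ^* ∘ φ) = linMat φ * linMat θ`. -/
theorem linMat_comp {N : ℕ} (φ : Fin N → MvPowerSeries (Fin N) k) {θ : Fin N → MvPowerSeries (Fin N) k}
    (hθ0 : ∀ i, constantCoeff (θ i) = 0) :
    FormalCoordChange.linMat (fun i => subst θ (φ i)) = FormalCoordChange.linMat φ * FormalCoordChange.linMat θ := by
  ext i j
  simp only [FormalCoordChange.linMat, Matrix.of_apply, Matrix.mul_apply]
  exact CobordantArc.coeff_degree_one_subst θ hθ0 (φ i) _ (Finsupp.degree_single _ _)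

/-- Composition of substitutions: `θ^*(φ^* f) = (θ^* ∘ φ)^* f`. -/
theorem subst_subst_eq_subst_comp {N : ℕ} {φ θ : Fin N → MvPowerSeries (Fin N) k}
    (hφ0 : ∀ i, constantCoeff (φ i) = 0) (hθ0 : ∀ i, constantCoeff (θ i) = 0) (f : MvPowerSeries (Fin N) k) :
    subst θ (subst φ f) = subst (fun i => subst θ (φ i)) f :=
  subst_comp_subst_apply (hasSubst_of_constantCoeff_zero hφ0) (hasSubst_of_constantCoeff_zero hθ0) f

/-- A compositional left inverse cancels: `ψ^*(φ^* f) = f` when `ψ^*(φ s) = x_s` for all `s`. -/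
theorem subst_subst_of_comp_eq_X {N : ℕ} {φ ψ : Fin N → MvPowerSeries (Fin N) k}
    (hφ0 : ∀ i, constantCoeff (φ i) = 0) (hψ0 : ∀ i, constantCoeff (ψ i) = 0)
    (hcomp : ∀ s, subst ψ (φ s) = X s) (f : MvPowerSeries (Fin N) k) : subst ψ (subst φ f) = f := by
  rw [subst_subst_eq_subst_comp hφ0 hψ0 f, show (fun s => subst ψ (φ s)) = X from funext hcomp, subst_self]
  rfl

/-- The compositional inverse of a formal coordinate change has invertible linear part. -/
theorem isUnit_det_linMat_of_comp_eq_X {N : ℕ} {φ ψ : Fin N → MvPowerSeries (Fin N) k}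
    (hψ0 : ∀ i, constantCoeff (ψ i) = 0) (hcomp : ∀ s, subst ψ (φ s) = X s) :
    IsUnit (FormalCoordChange.linMat ψ).det := by
  have h := congrArg Matrix.det (CobordantArc.linMat_mul_of_comp_eq_X hψ0 hcomp)
  rw [Matrix.det_mul, Matrix.det_one] at h
  exact IsUnit.of_mul_eq_one_right _ h

/-! ### Formal coordinate changes preserve the order -/

/-- A formal coordinate change (zero constant terms, invertible linear part) preserves the order. -/
theorem order_subst_eq_of_legal {N : ℕ} (θ : Fin N → MvPowerSeries (Fin N) k) (hθ0 : ∀ i, constantCoeff (θ i) = 0)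
    (hθdet : IsUnit (Matrix.det (Matrix.of fun i j : Fin N => coeff (Finsupp.single j 1) (θ i))))
    (f : MvPowerSeries (Fin N) k) : (subst θ f).order = f.order := by
  obtain ⟨ψ, hψ0, hψθ, -⟩ := FormalCoordChange.exists_comp_inverse hθ0 hθdet
  refine le_antisymm ?_ (ApexFreeOrderDrop.order_le_order_subst hθ0 f)
  have h := ApexFreeOrderDrop.order_le_order_subst hψ0 (subst θ f)
  rwa [subst_subst_of_comp_eq_X hθ0 hψ0 hψθ f] at h

/-! ### Unit factors -/

/-- In degrees `≤ ord T` the coefficients of `u · T` are `u(0)` times those of `T`. -/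
theorem coeff_unit_mul_of_degree_le {N : ℕ} (u T : MvPowerSeries (Fin N) k) {d : ℕ} (hT : (d : ℕ∞) ≤ T.order)
    {E : Fin N →₀ ℕ} (hE : E.degree ≤ d) : coeff E (u * T) = constantCoeff u * coeff E T := by
  classical
  rw [coeff_mul, Finset.sum_eq_single ((0 : Fin N →₀ ℕ), E)]
  · rw [coeff_zero_eq_constantCoeff_apply]
  · rintro ⟨p₁, p₂⟩ hp hne
    rw [Finset.HasAntidiagonal.mem_antidiagonal] at hp
    by_cases hp₁ : p₁ = 0
    · exfalso
      apply hne
      rw [hp₁, zero_add] at hp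
      rw [Prod.mk.injEq]
      exact ⟨hp₁, hp⟩
    · -- `p₂` has degree `< d ≤ ord T`
      have hdeg : p₂.degree < d := by
        have hsum : p₁.degree + p₂.degree = E.degree := by rw [← map_add, hp]
        have hpos : 0 < p₁.degree := by
          rw [pos_iff_ne_zero]
          exact fun h => hp₁ ((Finsupp.degree_eq_zero_iff p₁).mp h)
        omega
      rw [coeff_of_lt_order (lt_of_lt_of_le (by exact_mod_cast hdeg) hT), mul_zero]
  · intro h
    exact absurd (Finset.HasAntidiagonal.mem_antidiagonal.mpr (zero_add E)) h

/-- The degree-`d` form of `u · T` is `u(0)` times that of `T` (`d ≤ ord T`). -/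
theorem initEval_unit_mul {N : ℕ} (u T : MvPowerSeries (Fin N) k) {d : ℕ} (hT : (d : ℕ∞) ≤ T.order) (v : Fin N → k) :
    CobordantChart.initEval (fun _ : Fin N => 1) v d (u * T) =
      constantCoeff u * CobordantChart.initEval (fun _ : Fin N => 1) v d T := by
  rw [ApexFreeOrderDrop.initEval_one_eq_sum, ApexFreeOrderDrop.initEval_one_eq_sum, Finset.mul_sum]
  refine Finset.sum_congr rfl fun e he => ?_
  have hed : e.degree = d := by
    rw [← ApexFreeOrderDrop.weight_one_eq_degree]
    exact (ApexFreeOrderDrop.mem_antidiag_iff d e).mp he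
  rw [coeff_unit_mul_of_degree_le u T hT hed.le, mul_assoc]

/-- A unit factor does not change the order. -/
theorem order_unit_mul {N : ℕ} (u T : MvPowerSeries (Fin N) k) (hu : constantCoeff u ≠ 0) : (u * T).order = T.order := by
  have h0 : u.order = 0 := by
    by_contra h
    exact hu (order_ne_zero_iff_constCoeff_eq_zero.mp h)
  rw [MvPowerSeries.order_mul, h0, zero_add]

/-! ### Axis normalisation for every order (B5 without its unused hypotheses) -/

/-- B5 FOR EVERY ORDER (adapted verbatim from `stub_axisNormalize`, whose registered hypotheses `IsSingular` and `2 < d` its proof does not use):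
over an infinite field, a germ of order `d` whose degree-`d` form has a non-zero translation-invariance vector, all invariance vectors being
collinear, becomes an AXIS GERM (`AxisCone d`, `TrivialApexX d`, order `d`) after an invertible linear change of coordinates. -/
theorem axisNormalize [Infinite k] {m : ℕ} (f : MvPowerSeries (Fin (m + 1)) k) (d : ℕ) (hfd : f.order = d)
    (hone : ∃ c : Fin (m + 1) → k, c ≠ 0 ∧ ∀ v : Fin (m + 1) → k,
      CobordantChart.initEval (fun _ : Fin (m + 1) => 1) (v + c) d f = CobordantChart.initEval (fun _ : Fin (m + 1) => 1) v d f)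
    (hcol : ∀ c₁ c₂ : Fin (m + 1) → k,
      (∀ v : Fin (m + 1) → k, CobordantChart.initEval (fun _ : Fin (m + 1) => 1) (v + c₁) d f =
        CobordantChart.initEval (fun _ : Fin (m + 1) => 1) v d f) →
      (∀ v : Fin (m + 1) → k, CobordantChart.initEval (fun _ : Fin (m + 1) => 1) (v + c₂) d f =
        CobordantChart.initEval (fun _ : Fin (m + 1) => 1) v d f) →
      ∃ α β : k, (α ≠ 0 ∨ β ≠ 0) ∧ α • c₁ + β • c₂ = 0) :
    ∃ θ : Fin (m + 1) → MvPowerSeries (Fin (m + 1)) k, (∀ i, constantCoeff (θ i) = 0) ∧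
      IsUnit (Matrix.det (Matrix.of fun i j => coeff (Finsupp.single j 1) (θ i))) ∧
      (subst θ f).order = d ∧ AxisCone d (subst θ f) ∧ TrivialApexX d (subst θ f) := by
  classical
  obtain ⟨c, hc0, hc⟩ := hone
  -- (1) the matrix: invertible, last column `c`
  obtain ⟨M, hMdet, hMc⟩ := AxisNormalize.exists_matrix_lastCol c hc0
  have hMe : M.mulVec (Pi.single (Fin.last m) 1) = c := by
    rw [Matrix.mulVec_single_one]
    funext i
    rw [Matrix.col_apply, hMc]
  set θ := FormalCoordChange.linSubst M with hθ
  set g := subst θ f with hg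
  -- (2) + (3): the degree-`d` form of `g = f ∘ θ` is `P ∘ M`, invariant under all translations along `e_z`
  have hQ : ∀ v : Fin (m + 1) → k, CobordantChart.initEval (fun _ : Fin (m + 1) => 1) v d g =
      CobordantChart.initEval (fun _ : Fin (m + 1) => 1) (M.mulVec v) d f := fun v =>
    AxisNormalize.initEval_subst_linSubst 0 M v d f
  have hQz : ∀ (v : Fin (m + 1) → k) (t : k),
      CobordantChart.initEval (fun _ : Fin (m + 1) => 1) (v + t • Pi.single (Fin.last m) 1) d g =
        CobordantChart.initEval (fun _ : Fin (m + 1) => 1) v d g := by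
    intro v t
    rw [hQ, hQ, Matrix.mulVec_add, Matrix.mulVec_smul, hMe, AxisNormalize.initEval_add_smul hc]
  refine ⟨θ, ConeDichotomy.constantCoeff_linSubst M, ?_, ?_, ?_, ?_⟩
  · rw [hθ, ConeDichotomy.linMat_linSubst]
    exact hMdet
  · refine le_antisymm ?_ (ConeDichotomy.le_order_subst_of_le θ (ConeDichotomy.constantCoeff_linSubst M) f _ hfd.symm.le)
    have h := ApexFreeOrderDrop.order_le_order_subst (ConeDichotomy.constantCoeff_linSubst M⁻¹) g
    rwa [hg, hθ, FormalCoordChange.subst_linSubst_linSubst, Matrix.mul_nonsing_inv M hMdet,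
      FormalCoordChange.linSubst_one, MvPowerSeries.subst_self, id_eq, hfd] at h
  · -- AXIS CONE
    intro E hEd hEz
    have hmem : E ∈ (Finset.univ : Finset (Fin (m + 1))).finsuppAntidiag d := by
      rw [ApexFreeOrderDrop.mem_antidiag_iff, ApexFreeOrderDrop.weight_one_eq_degree, hEd]
    have h := AxisNormalize.coeff_eq_zero_of_eval_indep
      (∑ e ∈ (Finset.univ : Finset (Fin (m + 1))).finsuppAntidiag d, MvPolynomial.monomial e (coeff e g)) (fun v => ?_) hEz
    · rwa [ApexFreeOrderDrop.coeff_initForm, if_pos hmem] at h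
    · rw [ApexFreeOrderDrop.eval_initForm, ApexFreeOrderDrop.eval_initForm]
      conv_rhs => rw [AxisNormalize.eq_snoc_init_add_smul v, hQz]
      congr 1
      funext i
      rcases Fin.eq_castSucc_or_eq_last i with ⟨j, rfl⟩ | rfl
      · rw [if_neg (Fin.castSucc_lt_last j).ne, Fin.snoc_castSucc, Fin.init_def]
      · rw [if_pos rfl, Fin.snoc_last]
  · -- TRIVIAL APEX inside `z = 0`
    intro u hu
    by_contra hall
    push Not at hall
    apply hu
    have h1 : ∀ w : Fin (m + 1) → k,
        CobordantChart.initEval (fun _ : Fin (m + 1) => 1) (w + Fin.snoc u 0) d g =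
          CobordantChart.initEval (fun _ : Fin (m + 1) => 1) w d g := by
      intro w
      rw [AxisNormalize.eq_snoc_init_add_smul w, add_right_comm, hQz, hQz, hall]
    have h2 : ∀ v : Fin (m + 1) → k,
        CobordantChart.initEval (fun _ : Fin (m + 1) => 1) (v + M.mulVec (Fin.snoc u 0)) d f =
          CobordantChart.initEval (fun _ : Fin (m + 1) => 1) v d f := by
      intro v
      rw [← AxisNormalize.mulVec_nonsing_inv_mulVec hMdet v, ← Matrix.mulVec_add, ← hQ, ← hQ, h1]
    obtain ⟨α, β, hαβ, hlin⟩ := hcol c (M.mulVec (Fin.snoc u 0)) hc h2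
    have h3 : α • (Pi.single (Fin.last m) 1 : Fin (m + 1) → k) + β • Fin.snoc u 0 = 0 := by
      refine AxisNormalize.eq_zero_of_mulVec_eq_zero hMdet ?_
      rw [Matrix.mulVec_add, Matrix.mulVec_smul, Matrix.mulVec_smul, hMe, hlin]
    have hα : α = 0 := by
      have h := congr_fun h3 (Fin.last m)
      rwa [Pi.add_apply, Pi.smul_apply, Pi.smul_apply, Pi.single_eq_same, Fin.snoc_last, smul_zero, add_zero,
        smul_eq_mul, mul_one] at h
    have hβ : β ≠ 0 := hαβ.resolve_left (not_not.mpr hα)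
    funext j
    have h := congr_fun h3 (Fin.castSucc j)
    rw [Pi.add_apply, Pi.smul_apply, Pi.smul_apply, Pi.single_eq_of_ne (Fin.castSucc_lt_last j).ne, Fin.snoc_castSucc,
      smul_zero, zero_add, smul_eq_mul] at h
    exact (mul_eq_zero.mp h).resolve_left hβ

/-! ### The entry lemma: prepared axis presentations exist at isolated points with one-dimensional apex -/

/-- **ENTRY LEMMA OF REGIME (E1).**  Over an infinite field let `g` have order `d`, let the degree-`d` form of `g` have a one-dimensional apex
(`hone`, `hcol`), and let `g` be ISOLATED: no formal coordinate change makes it equimultiple along the axis.  Then some formal coordinate change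
`θ` (an invertible linear map followed by Hironaka's vertex dissolution B1) makes `g` a PREPARED AXIS GERM of order `d`:
`AxisCone`, `TrivialApexX`, `PreparedAxis`, and `¬ InAxisIdeal`. -/
theorem exists_prepared_presentation [Infinite k] (g : MvPowerSeries (Fin (n + 1)) k) (d : ℕ) (hgd : g.order = d)
    (hone : ∃ c : Fin (n + 1) → k, c ≠ 0 ∧ ∀ v : Fin (n + 1) → k,
      CobordantChart.initEval (fun _ : Fin (n + 1) => 1) (v + c) d g = CobordantChart.initEval (fun _ : Fin (n + 1) => 1) v d g)
    (hcol : ∀ c₁ c₂ : Fin (n + 1) → k,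
      (∀ v : Fin (n + 1) → k, CobordantChart.initEval (fun _ : Fin (n + 1) => 1) (v + c₁) d g =
        CobordantChart.initEval (fun _ : Fin (n + 1) => 1) v d g) →
      (∀ v : Fin (n + 1) → k, CobordantChart.initEval (fun _ : Fin (n + 1) => 1) (v + c₂) d g =
        CobordantChart.initEval (fun _ : Fin (n + 1) => 1) v d g) →
      ∃ α β : k, (α ≠ 0 ∨ β ≠ 0) ∧ α • c₁ + β • c₂ = 0)
    (hisol : ∀ Φ : Fin (n + 1) → MvPowerSeries (Fin (n + 1)) k, (∀ i, constantCoeff (Φ i) = 0) →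
      IsUnit (Matrix.det (Matrix.of fun i j => coeff (Finsupp.single j 1) (Φ i))) → ¬ InAxisIdeal d (subst Φ g)) :
    ∃ θ : Fin (n + 1) → MvPowerSeries (Fin (n + 1)) k, (∀ i, constantCoeff (θ i) = 0) ∧
      IsUnit (Matrix.det (Matrix.of fun i j => coeff (Finsupp.single j 1) (θ i))) ∧
      (subst θ g).order = d ∧ AxisCone d (subst θ g) ∧ TrivialApexX d (subst θ g) ∧ PreparedAxis d (subst θ g) ∧
      ¬ InAxisIdeal d (subst θ g) := by
  obtain ⟨θ₁, hθ₁0, hθ₁det, hord₁, hcone₁, hapex₁⟩ := axisNormalize g d hgd hone hcol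
  obtain ⟨ψ, -, hsh0, hshdet, hord, hcone, hapex, hcase⟩ := stub_axisPreparation k n d (subst θ₁ g) hord₁ hcone₁ hapex₁
  -- the composite coordinate change `θ = shear ∘ θ₁`
  set θ : Fin (n + 1) → MvPowerSeries (Fin (n + 1)) k := fun i => subst (shearFam ψ) (θ₁ i) with hθ
  have hθ0 : ∀ i, constantCoeff (θ i) = 0 := constantCoeff_comp_eq_zero hθ₁0 hsh0
  have hθdet : IsUnit (Matrix.det (Matrix.of fun i j => coeff (Finsupp.single j 1) (θ i))) := by
    change IsUnit (FormalCoordChange.linMat θ).det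
    rw [hθ, linMat_comp θ₁ hsh0, Matrix.det_mul]
    exact hθ₁det.mul hshdet
  have hcomp : subst θ g = subst (shearFam ψ) (subst θ₁ g) := (subst_subst_eq_subst_comp hθ₁0 hsh0 g).symm
  refine ⟨θ, hθ0, hθdet, ?_, ?_, ?_, ?_⟩
  · rw [hcomp]; exact hord
  · rw [hcomp]; exact hcone
  · rw [hcomp]; exact hapex
  · rcases hcase with hI | ⟨hnI, hprep⟩
    · exact absurd hI (hcomp ▸ hisol θ hθ0 hθdet)
    · exact ⟨hcomp ▸ hprep, hcomp ▸ hnI⟩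

end TOT2E1

end Summit.ResolutionOfSingularities.ResolutionOfSingularities.Theorems
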